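import Literature.GroupTheory.CombinatorialGroupTheory.RibbonBoundaryGluePrelim
import HarnessLib

/-!
# Boundary normal form of a one-vertex ribbon graph, II: gluing faces (induction on the number of faces)

Topic `Literature/GroupTheory/CombinatorialGroupTheory`; continues `RibbonBoundaryOneFace.lean`.
Let `Fs` be a SYSTEM of faces over the letters `ι × Bool` (ZVC §3.1): letters pairwise distinct,
the set of letters = all letters with symbol in `S ⊆ ι` (so partners come in pairs), no empty face
(unless the system is the disc `[[]]`), and ONE VERTEX: the vertex permutation `sysPerm Fs` is
transitive.  Dually this is a connected orientable ribbon graph with one vertex, edges `S`, and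
boundary cycles the faces; its fundamental group is the free group `F(S) ≤ F(ι)`.

**Theorem** (`exists_hom_of_sysPerm_transitive`, classification of compact orientable surfaces with
boundary, in the algebraic form of Zieschang–Vogt–Coldewey 3.1.5–3.1.8 / Thm. 3.2.6 / §4.14): there are
`g` with `2g + F = |S| + 1` (`F` = number of faces) and an INJECTIVE homomorphism
`θ : Γ_{g,F} = ⟨aᵢ, bᵢ, c_k ∣ ∏[aᵢ,bᵢ] c₁⋯c_F⟩ → F(ι)` with range `F(S)` whose cusp generators
`c_k` go to conjugates (by elements of `F(S)`) of the inverses of the boundary words, the assignment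
cusp ↦ face being a bijection (recorded as a list of pairs (image of `c_k`, face) whose second
components are a permutation of `Fs`).

Proof: induction on `F`.  One face = `exists_hom_of_one_face`.  For `F ≥ 2`, transitivity forces
an edge `y` whose two sides lie on DIFFERENT faces `Φ ∋ y`, `r ∋ ȳ` (`exists_faces_of_two_le`);
rotating them to `A ++ [y]`, `C ++ [ȳ]` and GLUING (ZVC 3.1.5: `sysPerm_glue_transitive`) gives a
one-vertex system `(A ++ C) :: Gs` over `S ∖ {y}` with one face less; if `θ'(c) = u (AC)⁻¹ u⁻¹`
there, the two new cusps go to `u C⁻¹ ŷ u⁻¹ = (uŷ⁻¹)(Cȳ)⁻¹(uŷ⁻¹)⁻¹` and `u ŷ⁻¹ A⁻¹ u⁻¹ =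
u (Ay)⁻¹ u⁻¹`, whose product is `θ'(c)`; injectivity of the new `θ` is the hopfian property of the
free group `Γ_{g,F}` of rank `2g + F - 1 = |S|` (`injective_of_range_eq_closure`).  Theorems only;
consumed by the punctured-surface-group form of the Reidemeister–Schreier method
(finite-index subgroups of `Γ_{g,r}`, Hoare–Karrass–Solitar).

## References

* H. Zieschang, E. Vogt, H.-D. Coldewey, *Surfaces and Planar Discontinuous Groups*, LNM 835,
  Springer 1980, 3.1.5–3.1.8, Thm. 3.2.6, §4.14. [ZieschangVogtColdewey1980]
-/

namespace Literature.GroupTheory.CombinatorialGroupTheory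

open List Equiv Equiv.Perm Function

universe u

variable {ι : Type u} [DecidableEq ι]

/-! ### The gluing step -/

/-- **The gluing step** (ZVC 3.1.5 with the cusp bookkeeping of §4.14): let `Φ :: r :: Gs` be a
one-vertex system over the symbols `S` with an edge `y ∈ Φ`, `ȳ ∈ r`.  If the boundary normal form
holds (with the stated bookkeeping) for every one-vertex system with `|Gs| + 1` faces — in particular
for the glued system `(A ++ C) :: Gs` over `S ∖ {y}`, `Φ ~ A ++ [y]`, `r ~ C ++ [ȳ]` — then it holds
for `Φ :: r :: Gs`. [cite: ZieschangVogtColdewey1980, 3.1.5] -/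
theorem normalForm_glue [Fintype ι] (S : Finset ι) (Φ r : List (ι × Bool))
    (Gs : List (List (ι × Bool))) (y : ι × Bool) (hy : y ∈ Φ) (hy' : bar y ∈ r)
    (hd : (Φ :: r :: Gs).flatten.Nodup) (hS : ∀ x : ι × Bool, x ∈ (Φ :: r :: Gs).flatten ↔ x.1 ∈ S)
    (hV : ∀ x ∈ (Φ :: r :: Gs).flatten, ∀ z ∈ (Φ :: r :: Gs).flatten,
      (sysPerm (Φ :: r :: Gs)).SameCycle x z)
    (hne : [] ∉ (Φ :: r :: Gs))
    (ih : ∀ (S' : Finset ι) (Fs' : List (List (ι × Bool))), Fs'.length = Gs.length + 1 →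
      Fs'.flatten.Nodup → (∀ x : ι × Bool, x ∈ Fs'.flatten ↔ x.1 ∈ S') →
      (∀ x ∈ Fs'.flatten, ∀ z ∈ Fs'.flatten, (sysPerm Fs').SameCycle x z) →
      ([] ∉ Fs' ∨ Fs' = [[]]) →
      ∃ g : ℕ, 2 * g + (Gs.length + 1) = S'.card + 1 ∧
        ∃ θ : PuncturedSurfaceGroup g (Gs.length + 1) →* FreeGroup ι, Injective θ ∧
          θ.range = Subgroup.closure ((fun i => FreeGroup.of i) '' (S' : Set ι)) ∧
          ∃ L : List (FreeGroup ι × List (ι × Bool)), L.map Prod.snd ~ Fs' ∧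
            (∃ hL : L.length = Gs.length + 1,
              ∀ j : Fin (Gs.length + 1), θ (PuncturedSurfaceGroup.c j) = (L.get (Fin.cast hL.symm j)).1) ∧
            ∀ p ∈ L, ∃ u ∈ θ.range, p.1 = u * (FreeGroup.mk p.2)⁻¹ * u⁻¹) :
    ∃ g : ℕ, 2 * g + (Gs.length + 2) = S.card + 1 ∧
      ∃ θ : PuncturedSurfaceGroup g (Gs.length + 2) →* FreeGroup ι, Injective θ ∧
        θ.range = Subgroup.closure ((fun i => FreeGroup.of i) '' (S : Set ι)) ∧
        ∃ L : List (FreeGroup ι × List (ι × Bool)), L.map Prod.snd ~ (Φ :: r :: Gs) ∧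
          (∃ hL : L.length = Gs.length + 2,
            ∀ j : Fin (Gs.length + 2), θ (PuncturedSurfaceGroup.c j) = (L.get (Fin.cast hL.symm j)).1) ∧
          ∀ p ∈ L, ∃ u ∈ θ.range, p.1 = u * (FreeGroup.mk p.2)⁻¹ * u⁻¹ := by
  classical
  set T : Subgroup (FreeGroup ι) := Subgroup.closure ((fun i => FreeGroup.of i) '' (S : Set ι)) with hT
  -- letters of the system have symbols in `S`
  have memT : ∀ W : List (ι × Bool), (∀ x ∈ W, x ∈ (Φ :: r :: Gs).flatten) → FreeGroup.mk W ∈ T :=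
    fun W hW => mk_mem_closure_of_forall_fst_mem S W fun x hx => (hS x).1 (hW x hx)
  have hΦF : ∀ x ∈ Φ, x ∈ (Φ :: r :: Gs).flatten := fun x hx => mem_flatten.2 ⟨Φ, by simp, hx⟩
  have hrF : ∀ x ∈ r, x ∈ (Φ :: r :: Gs).flatten := fun x hx => mem_flatten.2 ⟨r, by simp, hx⟩
  have hdr : r.Nodup := by
    rw [flatten_cons, flatten_cons] at hd; exact (nodup_append.1 (nodup_append.1 hd).2.1).1
  -- (1)–(2) rotate the two faces and glue them (`glue_prelim`)
  obtain ⟨P, Q, P', Q', hPQ, hPQ', hd', hS', hV', hne'⟩ := glue_prelim S Φ r Gs y hy hy' hd hS hV hne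
  set A := Q ++ P with hA
  set C := Q' ++ P' with hC
  set Fs' : List (List (ι × Bool)) := (A ++ C) :: Gs with hFs'
  have hyS : y.1 ∈ S := (hS y).1 (hΦF y hy)
  have hGs : [] ∉ Gs := fun h => hne (by simp [h])

  -- (3) the induction hypothesis for the glued system
  obtain ⟨g, hg, θ', hinj', hrange', L', hpermL', ⟨hL', hc'⟩, hconj'⟩ :=
    ih (S.erase y.1) Fs' rfl hd' hS' hV' hne'
  have hT'T : Subgroup.closure ((fun i => FreeGroup.of i) '' ((S.erase y.1 : Finset ι) : Set ι)) ≤ T :=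
    Subgroup.closure_mono (Set.image_mono (Finset.coe_subset.2 (Finset.erase_subset _ _)))
  have hθ'T : ∀ v, θ' v ∈ T := fun v => hT'T (by rw [← hrange']; exact ⟨v, rfl⟩)
  -- the cusp of the glued face
  have hACmem : A ++ C ∈ L'.map Prod.snd := hpermL'.symm.subset (by simp [hFs'])
  obtain ⟨p₀, hp₀L', hp₀2⟩ := mem_map.1 hACmem
  obtain ⟨k₀, hk₀, hk₀p⟩ := getElem_of_mem hp₀L'
  obtain ⟨u₀, hu₀r, hu₀⟩ := hconj' p₀ hp₀L'
  rw [hp₀2] at hu₀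
  -- the two new cusps
  set yh : FreeGroup ι := FreeGroup.mk [y] with hyh
  set ql : FreeGroup ι := u₀ * (FreeGroup.mk C)⁻¹ * yh * u₀⁻¹ with hql
  set qk : FreeGroup ι := u₀ * yh⁻¹ * (FreeGroup.mk A)⁻¹ * u₀⁻¹ with hqk
  have hqlqk : ql * qk = p₀.1 := by
    rw [hu₀, ← FreeGroup.mul_mk, hql, hqk]; group
  set L : List (FreeGroup ι × List (ι × Bool)) :=
    L'.take k₀ ++ [(ql, r), (qk, Φ)] ++ L'.drop (k₀ + 1) with hLdef
  have hLlen : L.length = Gs.length + 2 := by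
    simp only [hLdef, length_append, length_take, length_cons, length_nil, length_drop, hL']
    omega
  set M : List (FreeGroup ι) := L.map Prod.fst with hMdef
  have hMlen : M.length = Gs.length + 2 := by rw [hMdef, length_map, hLlen]
  set M' : List (FreeGroup ι) := L'.map Prod.fst with hM'def
  have hM'len : M'.length = Gs.length + 1 := by rw [hM'def, length_map, hL']
  have hk₀M' : k₀ < M'.length := by rw [hM'len, ← hL']; exact hk₀
  have hM'k₀ : M'[k₀] = p₀.1 := by simp only [hM'def, getElem_map, hk₀p]
  have hMeq : M = M'.take k₀ ++ [ql, qk] ++ M'.drop (k₀ + 1) := by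
    simp only [hMdef, hLdef, hM'def, map_append, map_cons, map_nil, map_take, map_drop]
  have hMprod : M.prod = M'.prod := by
    rw [hMeq, prod_append, prod_append, prod_cons, prod_cons, prod_nil, mul_one, hqlqk, ← hM'k₀,
      mul_assoc, ← prod_cons, ← drop_eq_getElem_cons hk₀M', prod_take_mul_prod_drop]
  -- (4) the homomorphism on `Γ_{g, |Gs|+2}`
  let f : puncturedSurfaceGen g (Gs.length + 2) → FreeGroup ι := fun x =>
    match x with
    | Sum.inl z => θ' (PresentedGroup.of (Sum.inl z))
    | Sum.inr j => M.get (Fin.cast hMlen.symm j)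
  let Φc : FreeGroup (Literature.Topology.FourManifolds.surfaceGen g) →* FreeGroup ι :=
    (θ'.comp (PresentedGroup.mk _)).comp (FreeGroup.map Sum.inl)
  have hΦc : ∀ z : Fin g × Bool, f (Sum.inl z) = Φc (FreeGroup.of z) := fun z => by
    simp only [f, Φc, MonoidHom.comp_apply, FreeGroup.map.of]; rfl
  have hΦc' : ∀ z : Fin g × Bool,
      (fun x : puncturedSurfaceGen g (Gs.length + 1) => θ' (PresentedGroup.of x)) (Sum.inl z) =
        Φc (FreeGroup.of z) := fun z => by
    simp only [Φc, MonoidHom.comp_apply, FreeGroup.map.of]; rfl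
  have hθ'mk : θ'.comp (PresentedGroup.mk _) =
      FreeGroup.lift (fun x : puncturedSurfaceGen g (Gs.length + 1) => θ' (PresentedGroup.of x)) :=
    FreeGroup.ext_hom _ _ fun x => by simp only [MonoidHom.comp_apply, FreeGroup.lift_apply_of]; rfl
  have hrel1 : (PresentedGroup.mk ({PuncturedSurfaceGroup.relator g (Gs.length + 1)} :
      Set (FreeGroup (puncturedSurfaceGen g (Gs.length + 1))))
      (PuncturedSurfaceGroup.relator g (Gs.length + 1))) = 1 :=
    (PresentedGroup.mk_eq_one_iff).2 (Subgroup.subset_normalClosure (Set.mem_singleton _))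
  have hrel : ∀ v ∈ ({PuncturedSurfaceGroup.relator g (Gs.length + 2)} :
      Set (FreeGroup (puncturedSurfaceGen g (Gs.length + 2)))), FreeGroup.lift f v = 1 := by
    intro v hv
    rw [Set.mem_singleton_iff] at hv
    rw [hv, PuncturedSurfaceGroup.relator, map_mul, lift_comm_eq g (Gs.length + 2) f Φc hΦc,
      lift_prod_genC_eq g (Gs.length + 2) f M hMlen (fun j => rfl), hMprod,
      ← lift_prod_genC_eq g (Gs.length + 1) (fun x => θ' (PresentedGroup.of x)) M' hM'len
        (fun j => by
          show θ' (PuncturedSurfaceGroup.c j) = (L'.map Prod.fst).get (Fin.cast hM'len.symm j)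
          rw [hc' j]; simp only [get_eq_getElem, getElem_map, Fin.val_cast]),
      ← lift_comm_eq g (Gs.length + 1) (fun x => θ' (PresentedGroup.of x)) Φc hΦc', ← map_mul,
      ← PuncturedSurfaceGroup.relator, ← hθ'mk, MonoidHom.comp_apply, hrel1, map_one]
  let θ : PuncturedSurfaceGroup g (Gs.length + 2) →* FreeGroup ι := PresentedGroup.toGroup hrel
  have hθa : ∀ z : Fin g × Bool, θ (PresentedGroup.of (Sum.inl z)) = θ' (PresentedGroup.of (Sum.inl z)) :=
    fun z => PresentedGroup.toGroup.of hrel (x := Sum.inl z)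
  have hθc : ∀ j : Fin (Gs.length + 2), θ (PuncturedSurfaceGroup.c j) = M.get (Fin.cast hMlen.symm j) :=
    fun j => PresentedGroup.toGroup.of hrel (x := Sum.inr j)
  -- (5) membership facts
  have hyT : yh ∈ T := memT [y] (fun x hx => by rw [mem_singleton.1 hx]; exact hΦF y hy)
  have hAT : FreeGroup.mk A ∈ T := memT A fun x hx => hΦF x (by
    rw [hPQ]; rw [hA] at hx
    rcases mem_append.1 hx with h | h
    · exact mem_append_right _ (mem_cons_of_mem _ h)
    · exact mem_append_left _ h)
  have hCsub : ∀ x ∈ C, x ∈ r ∧ x ≠ bar y := by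
    intro x hx
    have hdr' : (P' ++ bar y :: Q').Nodup := hPQ' ▸ hdr
    rw [hC] at hx
    rcases mem_append.1 hx with h | h
    · refine ⟨hPQ' ▸ mem_append_right _ (mem_cons_of_mem _ h), fun e => ?_⟩
      subst e
      exact (nodup_cons.1 (nodup_append.1 hdr').2.1).1 h
    · refine ⟨hPQ' ▸ mem_append_left _ h, fun e => ?_⟩
      subst e
      exact (disjoint_of_nodup_append hdr') h (mem_cons_self)
  have hCT' : FreeGroup.mk C ∈ θ'.range := by
    rw [hrange']
    refine mk_mem_closure_of_forall_fst_mem _ C fun x hx => ?_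
    rw [Finset.mem_erase]
    refine ⟨fun e => ?_, (hS x).1 (hrF x (hCsub x hx).1)⟩
    rcases eq_or_eq_bar_of_fst_eq e with rfl | rfl
    · -- `y ∈ Φ` and `y ∈ r`: impossible
      rw [flatten_cons, flatten_cons] at hd
      exact (disjoint_of_nodup_append hd) hy (mem_append_left _ (hCsub _ hx).1)
    · exact (hCsub _ hx).2 rfl
  have hCT : FreeGroup.mk C ∈ T := by
    obtain ⟨v, hv⟩ := hCT'; rw [← hv]; exact hθ'T v
  have hu₀T : u₀ ∈ T := by obtain ⟨v, hv⟩ := hu₀r; rw [← hv]; exact hθ'T v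
  have hPT : FreeGroup.mk P ∈ T := memT P fun x hx => hΦF x (by rw [hPQ]; exact mem_append_left _ hx)
  have hQT : FreeGroup.mk Q ∈ T :=
    memT Q fun x hx => hΦF x (by rw [hPQ]; exact mem_append_right _ (mem_cons_of_mem _ hx))
  have hP'T : FreeGroup.mk P' ∈ T := memT P' fun x hx => hrF x (by rw [hPQ']; exact mem_append_left _ hx)
  have hfaceT : ∀ p ∈ L', FreeGroup.mk p.2 ∈ T := by
    intro p hp
    have hp2 : p.2 ∈ Fs' := hpermL'.subset (mem_map.2 ⟨p, hp, rfl⟩)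
    exact hT'T (mk_mem_closure_of_forall_fst_mem _ p.2 fun x hx =>
      (hS' x).1 (mem_flatten.2 ⟨p.2, hp2, hx⟩))
  have hL'T : ∀ p ∈ L', p.1 ∈ T := by
    intro p hp
    obtain ⟨u, hu, hpu⟩ := hconj' p hp
    rw [hpu]
    obtain ⟨v, hv⟩ := hu
    exact mul_mem (mul_mem (hv ▸ hθ'T v) (inv_mem (hfaceT p hp))) (inv_mem (hv ▸ hθ'T v))
  have hqlT : ql ∈ T := mul_mem (mul_mem (mul_mem hu₀T (inv_mem hCT)) hyT) (inv_mem hu₀T)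
  have hqkT : qk ∈ T := mul_mem (mul_mem (mul_mem hu₀T (inv_mem hyT)) (inv_mem hAT)) (inv_mem hu₀T)
  have hMT : ∀ m ∈ M, m ∈ T := by
    intro m hm
    rw [hMeq] at hm
    simp only [mem_append, mem_cons, mem_nil_iff, or_false] at hm
    rcases hm with (hm | rfl | rfl) | hm
    · obtain ⟨p, hp, rfl⟩ := mem_map.1 (map_take .. ▸ hm : m ∈ (L'.take k₀).map Prod.fst)
      exact hL'T p (mem_of_mem_take hp)
    · exact hqlT
    · exact hqkT
    · obtain ⟨p, hp, rfl⟩ := mem_map.1 (map_drop .. ▸ hm : m ∈ (L'.drop (k₀ + 1)).map Prod.fst)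
      exact hL'T p (mem_of_mem_drop hp)
  -- (6) the range of `θ`
  have hrange_le : θ.range ≤ T := by
    rintro _ ⟨γ, rfl⟩
    refine PresentedGroup.induction_on (C := fun γ => θ γ ∈ T) γ fun v => ?_
    change FreeGroup.lift f v ∈ T
    have : (FreeGroup.lift f).range ≤ T := by
      rw [FreeGroup.range_lift_eq_closure, Subgroup.closure_le]
      rintro _ ⟨x, rfl⟩
      rcases x with z | j
      · exact hθ'T _
      · exact hMT _ (get_mem M _)
    exact this ⟨v, rfl⟩
  have hMrange : ∀ m ∈ M, m ∈ θ.range := by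
    intro m hm
    obtain ⟨i, hi, rfl⟩ := getElem_of_mem hm
    refine ⟨PuncturedSurfaceGroup.c ⟨i, by rw [← hMlen]; exact hi⟩, ?_⟩
    rw [hθc]; rfl
  have hqlrange : ql ∈ θ.range := by
    refine hMrange ql ?_
    rw [hMeq]; simp
  have hqkrange : qk ∈ θ.range := by
    refine hMrange qk ?_
    rw [hMeq]; simp
  have hrange'le : θ'.range ≤ θ.range := by
    rw [MonoidHom.range_eq_map, ← PresentedGroup.closure_range_of, MonoidHom.map_closure,
      Subgroup.closure_le]
    rintro _ ⟨_, ⟨x, rfl⟩, rfl⟩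
    rcases x with z | j
    · exact ⟨PresentedGroup.of (Sum.inl z), hθa z⟩
    · -- `θ' (c j) = M'[j]`, and every entry of `M'` lies in the range of `θ`
      have hM'range : ∀ m ∈ M', m ∈ θ.range := by
        intro m hm
        rw [← take_append_drop k₀ M', drop_eq_getElem_cons hk₀M', mem_append, mem_cons] at hm
        rcases hm with hm | rfl | hm
        · exact hMrange _ (by rw [hMeq]; simp [hm])
        · rw [hM'k₀, ← hqlqk]; exact mul_mem hqlrange hqkrange
        · exact hMrange _ (by rw [hMeq]; simp [hm])
      change θ' (PuncturedSurfaceGroup.c j) ∈ θ.range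
      rw [hc' j]
      refine hM'range _ ?_
      rw [hM'def]
      exact mem_map.2 ⟨_, get_mem L' _, rfl⟩
  have hrange_ge : T ≤ θ.range := by
    rw [hT, Subgroup.closure_le]
    rintro _ ⟨i, hi, rfl⟩
    by_cases hiy : i = y.1
    · -- `ŷ = C · u₀⁻¹ · ql · u₀` lies in the range
      have hyh' : yh ∈ θ.range := by
        have e : yh = FreeGroup.mk C * u₀⁻¹ * ql * u₀ := by rw [hql]; group
        rw [e]
        exact mul_mem (mul_mem (mul_mem (hrange'le hCT') (inv_mem (hrange'le hu₀r))) hqlrange)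
          (hrange'le hu₀r)
      subst hiy
      obtain ⟨i, _ | _⟩ := y
      · have e : FreeGroup.mk [((i, false) : ι × Bool)] = (FreeGroup.of i)⁻¹ := rfl
        rw [hyh, e] at hyh'
        exact (inv_mem_iff).1 hyh'
      · exact hyh'
    · exact hrange'le (by
        rw [hrange']
        exact Subgroup.subset_closure ⟨i, by simp [hiy, hi], rfl⟩)
  have hrangeθ : θ.range = T := le_antisymm hrange_le hrange_ge
  -- (7) injectivity (hopfian) and the count
  have hcardS : 2 * g + (Gs.length + 1) = S.card := by
    have := Finset.card_erase_of_mem hyS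
    have h1 : 1 ≤ S.card := Finset.card_pos.2 ⟨y.1, hyS⟩
    omega
  obtain ⟨e⟩ := PuncturedSurfaceGroup.nonempty_mulEquiv_freeGroup g (Gs.length + 1)
  have hinj : Injective θ := by
    refine injective_of_range_eq_closure e S ?_ θ hrangeθ
    simp only [Nat.card_eq_fintype_card, Fintype.card_sum, Fintype.card_prod, Fintype.card_fin,
      Fintype.card_bool]
    omega
  refine ⟨g, by omega, θ, hinj, hrangeθ, L, ?_, ⟨hLlen, fun j => ?_⟩, ?_⟩
  · -- the faces attached to the cusps are a permutation of `Φ :: r :: Gs`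
    set N' := L'.map Prod.snd with hN'def
    have hk₀N' : k₀ < N'.length := by rw [hN'def, length_map]; exact hk₀
    have hN'k₀ : N'[k₀] = A ++ C := by simp only [hN'def, getElem_map, hk₀p, hp₀2]
    have hrest : N'.take k₀ ++ N'.drop (k₀ + 1) ~ Gs := by
      have e : N' = N'.take k₀ ++ (A ++ C) :: N'.drop (k₀ + 1) := by
        conv_lhs => rw [← take_append_drop k₀ N', drop_eq_getElem_cons hk₀N', hN'k₀]
      have h1 : N' ~ (A ++ C) :: (N'.take k₀ ++ N'.drop (k₀ + 1)) := by
        conv_lhs => rw [e]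
        exact perm_middle
      exact (Perm.cons_inv (h1.symm.trans hpermL'))
    have e2 : L.map Prod.snd = N'.take k₀ ++ r :: Φ :: N'.drop (k₀ + 1) := by
      simp only [hLdef, hN'def, map_append, map_cons, map_take, map_drop, cons_append,
        nil_append, append_assoc]
    rw [e2]
    refine (perm_middle.trans (Perm.cons r perm_middle)).trans ?_
    exact ((Perm.cons r (Perm.cons Φ hrest)).trans (Perm.swap Φ r Gs))
  · rw [hθc]
    show (L.map Prod.fst).get (Fin.cast hMlen.symm j) = _
    simp only [get_eq_getElem, getElem_map, Fin.val_cast]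
  · -- the conjugacy bookkeeping
    intro p hp
    rw [hLdef] at hp
    simp only [mem_append, mem_cons, mem_nil_iff, or_false] at hp
    rcases hp with (hp | rfl | rfl) | hp
    · obtain ⟨u, hu, hpu⟩ := hconj' p (mem_of_mem_take hp)
      exact ⟨u, hrange'le hu, hpu⟩
    · refine ⟨u₀ * (FreeGroup.mk P')⁻¹, mul_mem (hrange'le hu₀r) (inv_mem (hrangeθ ▸ hP'T)), ?_⟩
      change ql = _ * (FreeGroup.mk r)⁻¹ * _
      have er : FreeGroup.mk r = FreeGroup.mk P' * yh⁻¹ * FreeGroup.mk Q' := by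
        rw [hPQ', ← singleton_append, ← FreeGroup.mul_mk, ← FreeGroup.mul_mk, mk_bar_singleton, mul_assoc]
      have eC : FreeGroup.mk C = FreeGroup.mk Q' * FreeGroup.mk P' := by rw [hC, FreeGroup.mul_mk]
      rw [hql, er, eC]; group
    · refine ⟨u₀ * FreeGroup.mk Q, mul_mem (hrange'le hu₀r) (hrangeθ ▸ hQT), ?_⟩
      change qk = _ * (FreeGroup.mk Φ)⁻¹ * _
      have eΦ : FreeGroup.mk Φ = FreeGroup.mk P * yh * FreeGroup.mk Q := by
        rw [hPQ, ← singleton_append, ← FreeGroup.mul_mk, ← FreeGroup.mul_mk, mul_assoc]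
      have eA : FreeGroup.mk A = FreeGroup.mk Q * FreeGroup.mk P := by rw [hA, FreeGroup.mul_mk]
      rw [hqk, eΦ, eA]; group
    · obtain ⟨u, hu, hpu⟩ := hconj' p (mem_of_mem_drop hp)
      exact ⟨u, hrange'le hu, hpu⟩

/-! ### The induction and the theorem -/

/-- The induction on the number of faces (auxiliary form with the face count as a parameter).
[cite: ZieschangVogtColdewey1980, 3.1.5] -/
theorem normalForm_aux [Fintype ι] (n : ℕ) :
    ∀ (S : Finset ι) (Fs : List (List (ι × Bool))), Fs.length = n + 1 → Fs.flatten.Nodup →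
      (∀ x : ι × Bool, x ∈ Fs.flatten ↔ x.1 ∈ S) →
      (∀ x ∈ Fs.flatten, ∀ z ∈ Fs.flatten, (sysPerm Fs).SameCycle x z) →
      ([] ∉ Fs ∨ Fs = [[]]) →
      ∃ g : ℕ, 2 * g + (n + 1) = S.card + 1 ∧
        ∃ θ : PuncturedSurfaceGroup g (n + 1) →* FreeGroup ι, Injective θ ∧
          θ.range = Subgroup.closure ((fun i => FreeGroup.of i) '' (S : Set ι)) ∧
          ∃ L : List (FreeGroup ι × List (ι × Bool)), L.map Prod.snd ~ Fs ∧
            (∃ hL : L.length = n + 1,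
              ∀ j : Fin (n + 1), θ (PuncturedSurfaceGroup.c j) = (L.get (Fin.cast hL.symm j)).1) ∧
            ∀ p ∈ L, ∃ u ∈ θ.range, p.1 = u * (FreeGroup.mk p.2)⁻¹ * u⁻¹ := by
  classical
  induction n with
  | zero =>
    intro S Fs hlen hd hS hV hne
    obtain ⟨w, rfl⟩ : ∃ w, Fs = [w] := by
      match Fs, hlen with
      | [w], _ => exact ⟨w, rfl⟩
    have hfl : [w].flatten = w := by simp
    rw [hfl] at hd hS hV
    rw [sysPerm_singleton] at hV
    obtain ⟨h, hh, θ, hinj, hrange, u, hu, hθu⟩ := exists_hom_of_one_face S w hd hS hV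
    refine ⟨h, hh, θ, hinj, hrange, [(θ (PuncturedSurfaceGroup.c 0), w)], by simp, ⟨rfl, fun j => ?_⟩, ?_⟩
    · obtain ⟨j, hj⟩ := j
      have hj0 : j = 0 := by omega
      subst hj0; rfl
    · intro p hp
      rw [mem_singleton] at hp
      subst hp
      exact ⟨u, hu, hθu⟩
  | succ n ih =>
    intro S Fs hlen hd hS hV hne
    have hne1 : [] ∉ Fs := by
      rcases hne with h | h
      · exact h
      · rw [h] at hlen; simp at hlen
    have hc : Closed Fs.flatten := fun x hx => (hS (bar x)).2 ((hS x).1 hx)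
    obtain ⟨Φ, r, Gs, y, hperm, hy, hy'⟩ :=
      exists_faces_of_two_le hd hc hV hne1 (by rw [hlen]; omega)
    have hGs : Gs.length = n := by
      have := hperm.length_eq; rw [hlen] at this; simp at this; omega
    subst hGs
    have hd₂ : (Φ :: r :: Gs).flatten.Nodup := hperm.flatten.nodup_iff.1 hd
    have hS₂ : ∀ x : ι × Bool, x ∈ (Φ :: r :: Gs).flatten ↔ x.1 ∈ S := fun x => by
      rw [← hS x]; exact hperm.flatten.symm.mem_iff
    have hV₂ : ∀ x ∈ (Φ :: r :: Gs).flatten, ∀ z ∈ (Φ :: r :: Gs).flatten,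
        (sysPerm (Φ :: r :: Gs)).SameCycle x z := fun x hx z hz => by
      rw [← sysPerm_eq_of_perm hd hperm]
      exact hV x (hperm.flatten.symm.mem_iff.1 hx) z (hperm.flatten.symm.mem_iff.1 hz)
    have hne₂ : [] ∉ (Φ :: r :: Gs) := fun h => hne1 (hperm.symm.subset h)
    obtain ⟨g, hg, θ, hinj, hrange, L, hL, hrest⟩ :=
      normalForm_glue S Φ r Gs y hy hy' hd₂ hS₂ hV₂ hne₂ (fun S' Fs' hl => ih S' Fs' hl)
    exact ⟨g, hg, θ, hinj, hrange, L, hL.trans hperm.symm, hrest⟩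

/-- **Boundary normal form of a one-vertex ribbon graph / classification of compact orientable
surfaces with boundary, algebraic form** (Zieschang–Vogt–Coldewey 3.1.5–3.1.8, Thm. 3.2.6, as used
in §4.14).  Let `Fs ≠ []` be a system of faces over `ι × Bool` whose letters are pairwise distinct
and are exactly the letters with symbol in `S`, with no empty face (unless `Fs = [[]]`), and whose
vertex permutation is transitive.  Then for some `g` with `2g + |Fs| = |S| + 1` there is an
injective homomorphism `θ : Γ_{g,|Fs|} → F(ι)` with range the subgroup `F(S)` generated by the
symbols of `S`, and a list `L` of pairs (cusp image, face), `θ(c_j) = L[j].1`, whose faces are a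
permutation of `Fs` and in which every cusp image is a conjugate, by an element of `F(S)`, of the
inverse of its face word. [cite: ZieschangVogtColdewey1980, Thm 3.2.6 / 3.1.8 / 4.14] -/
theorem exists_hom_of_sysPerm_transitive [Fintype ι] (S : Finset ι) (Fs : List (List (ι × Bool)))
    (hF : Fs ≠ []) (hd : Fs.flatten.Nodup) (hS : ∀ x : ι × Bool, x ∈ Fs.flatten ↔ x.1 ∈ S)
    (hV : ∀ x ∈ Fs.flatten, ∀ z ∈ Fs.flatten, (sysPerm Fs).SameCycle x z)
    (hne : [] ∉ Fs ∨ Fs = [[]]) :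
    ∃ g : ℕ, 2 * g + Fs.length = S.card + 1 ∧
      ∃ θ : PuncturedSurfaceGroup g Fs.length →* FreeGroup ι, Injective θ ∧
        θ.range = Subgroup.closure ((fun i => FreeGroup.of i) '' (S : Set ι)) ∧
        ∃ L : List (FreeGroup ι × List (ι × Bool)), L.map Prod.snd ~ Fs ∧
          (∃ hL : L.length = Fs.length,
            ∀ j : Fin Fs.length, θ (PuncturedSurfaceGroup.c j) = (L.get (Fin.cast hL.symm j)).1) ∧
          ∀ p ∈ L, ∃ u ∈ θ.range, p.1 = u * (FreeGroup.mk p.2)⁻¹ * u⁻¹ := by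
  obtain ⟨n, hn⟩ := Nat.exists_eq_succ_of_ne_zero (fun h => hF (length_eq_zero_iff.1 h))
  rw [hn]
  exact normalForm_aux n S Fs hn hd hS hV hne

end Literature.GroupTheory.CombinatorialGroupTheory
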